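import Mathlib
import Literature.Analysis.PDE.Wave1DExteriorEnergy
import HarnessLib

/-!
# The 1+1 wave equation with a potential and a SOURCE: trapezoid energy identity and energy inequality

Analysis/PDE support file (everything proved). Companion of `Wave1DTrapezoidEnergy.lean` for the
inhomogeneous equation `ψ_tt − ψ_xx + V(x)ψ = F(t, x)` on the line (curried `ψ : ℝ → ℝ → ℝ`, time
first), energy density `e = ψ_t² + ψ_x² + Vψ²`, characteristic trapezoid
`T = {s ≤ τ ≤ t, a + τ ≤ x ≤ b − τ}`:

* `trapezoid_energy_identity_source` / `wave1D_trapezoid_energy_identity_source` — the energy–flux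
  identity acquires the bulk term `+ 2 ∫_s^t ∫_{a+τ}^{b−τ} ψ_t F` (first-order form and `C²` form);
* `wave1D_trapezoid_energy_sub_le_source` — for `V ≥ 0`, `E(t) − E(s) ≤ 2 ∫_s^t ∫ ψ_t F`;
* the Duhamel-type bound for zero Cauchy data (`E(t) ≤ 4(∫_0^t ‖F(τ,·)‖_{L²} dτ)²`) built on
  these is in `Wave1DDuhamelBound.lean`.

This is the perturbative engine of the near-horizon channel estimate for `FixedModeChannels`
(route PhotonSphereChannels, stmt-FinalStateConjecture-10048): the difference of the true and the
free evolution solves the free equation with source `−Vψ` and zero data.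

References: L. C. Evans, *Partial Differential Equations*, 2nd ed. (2010), §2.4.3; F. John,
*Partial Differential Equations*, 4th ed., Ch. 5 (energy inequalities). Standard; folklore.
-/

noncomputable section

namespace Literature.Analysis.PDE

open MeasureTheory Set Filter Topology intervalIntegral Literature.Analysis.Calculus

section SourceIdentity

variable {V : ℝ → ℝ} {F ψ ψt ψx ψtx ψxx : ℝ → ℝ → ℝ}

/-- **Energy–flux identity with a source on a characteristic trapezoid** (first-order form): as
`trapezoid_energy_identity`, for `∂_τ ψt = ψxx − Vψ + F` (the equation `ψ_tt − ψ_xx + Vψ = F`):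
`∫_{a+t}^{b−t} e(t,·) − ∫_{a+s}^{b−s} e(s,·) = −(left flux) − (right flux) + 2∫_s^t ∫_{a+τ}^{b−τ} ψt F`.
[folklore] -/
theorem trapezoid_energy_identity_source (hV : Continuous V) (hF : Continuous (Function.uncurry F))
    (hψ : Continuous (Function.uncurry ψ)) (hψt : Continuous (Function.uncurry ψt))
    (hψx : Continuous (Function.uncurry ψx)) (hψtx : Continuous (Function.uncurry ψtx))
    (hψxx : Continuous (Function.uncurry ψxx))
    (h1 : ∀ t x, HasDerivAt (fun τ => ψ τ x) (ψt t x) t)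
    (h3 : ∀ t x, HasDerivAt (fun τ => ψt τ x) (ψxx t x - V x * ψ t x + F t x) t)
    (h4 : ∀ t x, HasDerivAt (fun τ => ψx τ x) (ψtx t x) t)
    (h5 : ∀ t x, HasDerivAt (ψt t) (ψtx t x) x)
    (h6 : ∀ t x, HasDerivAt (ψx t) (ψxx t x) x)
    {a b s t : ℝ} (hst : s ≤ t) (hab : a + t ≤ b - t) :
    (∫ x in (a + t)..(b - t), (ψt t x ^ 2 + ψx t x ^ 2 + V x * ψ t x ^ 2))
      - ∫ x in (a + s)..(b - s), (ψt s x ^ 2 + ψx s x ^ 2 + V x * ψ s x ^ 2)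
    = -(∫ x in (a + s)..(a + t), ((ψt (x - a) x + ψx (x - a) x) ^ 2 + V x * ψ (x - a) x ^ 2))
      - (∫ x in (b - t)..(b - s), ((ψt (b - x) x - ψx (b - x) x) ^ 2 + V x * ψ (b - x) x ^ 2))
      + 2 * ∫ τ in s..t, ∫ x in (a + τ)..(b - τ), ψt τ x * F τ x := by
  -- energy density, flux, and their derivatives
  set e : ℝ → ℝ → ℝ := fun τ x => ψt τ x ^ 2 + ψx τ x ^ 2 + V x * ψ τ x ^ 2 with he_def
  set fl : ℝ → ℝ → ℝ := fun τ x => 2 * (ψt τ x * ψx τ x) with hfl_def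
  set g0 : ℝ → ℝ → ℝ := fun τ x => 2 * (ψt τ x * ψxx τ x + ψx τ x * ψtx τ x) with hg0_def
  set g : ℝ → ℝ → ℝ := fun τ x => g0 τ x + 2 * (ψt τ x * F τ x) with hg_def
  -- continuity bookkeeping
  have hcont2 : ∀ {φ : ℝ → ℝ → ℝ}, Continuous (Function.uncurry φ) →
      ∀ {u v : ℝ → ℝ}, Continuous u → Continuous v → Continuous fun y => φ (u y) (v y) :=
    fun hφ u v hu hv => hφ.comp (hu.prodMk hv)
  have he_cont : Continuous (Function.uncurry e) := by
    have h1' := hψt; have h2' := hψx; have h3' := hψ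
    show Continuous fun p : ℝ × ℝ => ψt p.1 p.2 ^ 2 + ψx p.1 p.2 ^ 2 + V p.2 * ψ p.1 p.2 ^ 2
    have ha : Continuous fun p : ℝ × ℝ => ψt p.1 p.2 := hψt
    have hb : Continuous fun p : ℝ × ℝ => ψx p.1 p.2 := hψx
    have hc : Continuous fun p : ℝ × ℝ => ψ p.1 p.2 := hψ
    have hd : Continuous fun p : ℝ × ℝ => V p.2 := hV.comp continuous_snd
    fun_prop
  have hg0_cont : Continuous (Function.uncurry g0) := by
    show Continuous fun p : ℝ × ℝ => 2 * (ψt p.1 p.2 * ψxx p.1 p.2 + ψx p.1 p.2 * ψtx p.1 p.2)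
    have ha : Continuous fun p : ℝ × ℝ => ψt p.1 p.2 := hψt
    have hb : Continuous fun p : ℝ × ℝ => ψx p.1 p.2 := hψx
    have hc : Continuous fun p : ℝ × ℝ => ψtx p.1 p.2 := hψtx
    have hd : Continuous fun p : ℝ × ℝ => ψxx p.1 p.2 := hψxx
    fun_prop
  have hsrc_cont : Continuous (Function.uncurry fun τ x => 2 * (ψt τ x * F τ x)) := by
    show Continuous fun p : ℝ × ℝ => 2 * (ψt p.1 p.2 * F p.1 p.2)
    have ha : Continuous fun p : ℝ × ℝ => ψt p.1 p.2 := hψt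
    have hb : Continuous fun p : ℝ × ℝ => F p.1 p.2 := hF
    fun_prop
  have hg_cont : Continuous (Function.uncurry g) := by
    show Continuous fun p : ℝ × ℝ => g0 p.1 p.2 + 2 * (ψt p.1 p.2 * F p.1 p.2)
    exact hg0_cont.add hsrc_cont
  have hfl_cont : Continuous (Function.uncurry fl) := by
    show Continuous fun p : ℝ × ℝ => 2 * (ψt p.1 p.2 * ψx p.1 p.2)
    have ha : Continuous fun p : ℝ × ℝ => ψt p.1 p.2 := hψt
    have hb : Continuous fun p : ℝ × ℝ => ψx p.1 p.2 := hψx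
    fun_prop
  -- pointwise: `∂_τ e = g` and `∂ₓ fl = g`
  have he_deriv : ∀ x τ, HasDerivAt (fun τ => e τ x) (g τ x) τ := by
    intro x τ
    have ha := (h3 τ x).pow 2
    have hb := (h4 τ x).pow 2
    have hc := ((h1 τ x).pow 2).const_mul (V x)
    have := (ha.add hb).add hc
    refine this.congr_deriv ?_
    simp only [hg_def, hg0_def]
    push_cast
    ring
  have hfl_deriv : ∀ τ x, HasDerivAt (fun x => fl τ x) (g0 τ x) x := by
    intro τ x
    have := ((h5 τ x).mul (h6 τ x)).const_mul 2
    refine this.congr_deriv ?_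
    simp only [hg0_def]
    ring
  -- Fubini on the trapezoid for `g`
  have hswap := trapezoid_integral_swap (G := Function.uncurry g) hg_cont hst hab
  simp only [Function.uncurry_apply_pair] at hswap
  -- inner integrals by the fundamental theorem of calculus
  have hinner1 : ∀ τ, (∫ x in (a + τ)..(b - τ), g τ x)
      = (fl τ (b - τ) - fl τ (a + τ)) + ∫ x in (a + τ)..(b - τ), 2 * (ψt τ x * F τ x) := by
    intro τ
    have i1 : IntervalIntegrable (fun x => g0 τ x) volume (a + τ) (b - τ) :=
      (hcont2 hg0_cont continuous_const continuous_id).intervalIntegrable _ _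
    have i2 : IntervalIntegrable (fun x => 2 * (ψt τ x * F τ x)) volume (a + τ) (b - τ) :=
      (hcont2 hsrc_cont continuous_const continuous_id).intervalIntegrable _ _
    rw [show (fun x => g τ x) = fun x => g0 τ x + 2 * (ψt τ x * F τ x) from rfl,
      integral_add i1 i2, integral_eq_sub_of_hasDerivAt (fun x _ => hfl_deriv τ x) i1]
  have hinner2 : ∀ x m, (∫ τ in s..m, g τ x) = e m x - e s x := by
    intro x m
    refine integral_eq_sub_of_hasDerivAt (fun τ _ => he_deriv x τ) ?_
    exact ((hcont2 hg_cont continuous_id continuous_const).intervalIntegrable _ _)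
  simp_rw [hinner1, hinner2] at hswap
  -- left side of `hswap`: the two characteristic fluxes, reparametrised by `x`
  have hS_cont : Continuous fun τ => ∫ x in (a + τ)..(b - τ), 2 * (ψt τ x * F τ x) := by
    have hP := intervalIntegral.continuous_parametric_primitive_of_continuous (μ := volume)
      (a₀ := (0 : ℝ)) hsrc_cont
    have c1 : Continuous fun τ : ℝ => ∫ x in (0 : ℝ)..(b - τ), 2 * (ψt τ x * F τ x) :=
      hP.comp (continuous_id.prodMk (continuous_const.sub continuous_id))
    have c2 : Continuous fun τ : ℝ => ∫ x in (0 : ℝ)..(a + τ), 2 * (ψt τ x * F τ x) :=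
      hP.comp (continuous_id.prodMk (continuous_const.add continuous_id))
    have heq : (fun τ => ∫ x in (a + τ)..(b - τ), 2 * (ψt τ x * F τ x))
        = fun τ => (∫ x in (0 : ℝ)..(b - τ), 2 * (ψt τ x * F τ x))
          - ∫ x in (0 : ℝ)..(a + τ), 2 * (ψt τ x * F τ x) := by
      funext τ
      have i1 : IntervalIntegrable (fun x => 2 * (ψt τ x * F τ x)) volume 0 (b - τ) :=
        (hcont2 hsrc_cont continuous_const continuous_id).intervalIntegrable _ _
      have i2 : IntervalIntegrable (fun x => 2 * (ψt τ x * F τ x)) volume 0 (a + τ) :=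
        (hcont2 hsrc_cont continuous_const continuous_id).intervalIntegrable _ _
      exact (integral_interval_sub_left i1 i2).symm
    rw [heq]
    exact c1.sub c2
  have hL : (∫ τ in s..t, ((fl τ (b - τ) - fl τ (a + τ))
        + ∫ x in (a + τ)..(b - τ), 2 * (ψt τ x * F τ x)))
      = ((∫ x in (b - t)..(b - s), fl (b - x) x) - ∫ x in (a + s)..(a + t), fl (x - a) x)
        + 2 * ∫ τ in s..t, ∫ x in (a + τ)..(b - τ), ψt τ x * F τ x := by
    have c1 : Continuous fun τ => fl τ (b - τ) :=
      hcont2 hfl_cont continuous_id (continuous_const.sub continuous_id)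
    have c2 : Continuous fun τ => fl τ (a + τ) :=
      hcont2 hfl_cont continuous_id (continuous_const.add continuous_id)
    have c12 : Continuous fun τ => fl τ (b - τ) - fl τ (a + τ) := c1.sub c2
    rw [integral_add (c12.intervalIntegrable _ _) (hS_cont.intervalIntegrable _ _),
      integral_sub (c1.intervalIntegrable _ _) (c2.intervalIntegrable _ _)]
    have hsrc2 : (∫ τ in s..t, ∫ x in (a + τ)..(b - τ), 2 * (ψt τ x * F τ x))
        = 2 * ∫ τ in s..t, ∫ x in (a + τ)..(b - τ), ψt τ x * F τ x := by
      rw [← intervalIntegral.integral_const_mul]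
      refine integral_congr fun τ _ => ?_
      exact intervalIntegral.integral_const_mul _ _
    rw [hsrc2]
    congr 1
    congr 1
    · rw [← integral_comp_sub_left (fun x => fl (b - x) x) b]
      simp
    · rw [show a + s = s + a by ring, show a + t = t + a by ring,
        ← integral_comp_add_right (fun x => fl (x - a) x) a]
      simp [add_comm]
  -- right side of `hswap`: split `[a + s, b - s]` into three pieces
  set m : ℝ → ℝ := fun x => min t (min (x - a) (b - x)) with hm_def
  have hm_cont : Continuous m := by
    simp only [hm_def]; fun_prop
  have htop_cont : Continuous fun x => e (m x) x := hcont2 he_cont hm_cont continuous_id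
  have hii : ∀ u v, IntervalIntegrable (fun x => e (m x) x) volume u v :=
    fun u v => htop_cont.intervalIntegrable u v
  have hR : (∫ x in (a + s)..(b - s), (e (m x) x - e s x))
      = (∫ x in (a + s)..(a + t), e (x - a) x) + (∫ x in (a + t)..(b - t), e t x)
        + (∫ x in (b - t)..(b - s), e (b - x) x) - ∫ x in (a + s)..(b - s), e s x := by
    have c3 : Continuous fun x => e s x := hcont2 he_cont continuous_const continuous_id
    rw [integral_sub (hii _ _) (c3.intervalIntegrable _ _)]
    congr 1
    rw [← integral_add_adjacent_intervals (hii (a + s) (a + t)) (hii (a + t) (b - s)),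
      ← integral_add_adjacent_intervals (hii (a + t) (b - t)) (hii (b - t) (b - s))]
    have e1 : (∫ x in (a + s)..(a + t), e (m x) x) = ∫ x in (a + s)..(a + t), e (x - a) x := by
      refine integral_congr fun x hx => ?_
      rw [uIcc_of_le (by linarith)] at hx
      have : m x = x - a := by
        simp only [hm_def]
        rw [min_eq_right_iff.2, min_eq_left]
        · linarith [hx.2]
        · exact min_le_of_left_le (by linarith [hx.2])
      simp only [this]
    have e2 : (∫ x in (a + t)..(b - t), e (m x) x) = ∫ x in (a + t)..(b - t), e t x := by
      refine integral_congr fun x hx => ?_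
      rw [uIcc_of_le hab] at hx
      have : m x = t := by
        simp only [hm_def]
        exact min_eq_left (le_min (by linarith [hx.1]) (by linarith [hx.2]))
      simp only [this]
    have e3 : (∫ x in (b - t)..(b - s), e (m x) x) = ∫ x in (b - t)..(b - s), e (b - x) x := by
      refine integral_congr fun x hx => ?_
      rw [uIcc_of_le (by linarith)] at hx
      have : m x = b - x := by
        simp only [hm_def]
        rw [min_eq_right_iff.2, min_eq_right]
        · linarith [hx.1]
        · exact min_le_of_right_le (by linarith [hx.1])
      simp only [this]
    rw [e1, e2, e3]
    ring
  rw [hL, hR] at hswap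
  -- the goal's flux integrands are `e + fl` and `e - fl`
  have hA : (∫ x in (a + s)..(a + t), ((ψt (x - a) x + ψx (x - a) x) ^ 2 + V x * ψ (x - a) x ^ 2))
      = (∫ x in (a + s)..(a + t), e (x - a) x) + ∫ x in (a + s)..(a + t), fl (x - a) x := by
    have c4 : Continuous fun x => e (x - a) x :=
      hcont2 he_cont (continuous_id.sub continuous_const) continuous_id
    have c5 : Continuous fun x => fl (x - a) x :=
      hcont2 hfl_cont (continuous_id.sub continuous_const) continuous_id
    rw [← integral_add (c4.intervalIntegrable _ _) (c5.intervalIntegrable _ _)]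
    refine integral_congr fun x _ => ?_
    simp only [he_def, hfl_def]
    ring
  have hC : (∫ x in (b - t)..(b - s), ((ψt (b - x) x - ψx (b - x) x) ^ 2 + V x * ψ (b - x) x ^ 2))
      = (∫ x in (b - t)..(b - s), e (b - x) x) - ∫ x in (b - t)..(b - s), fl (b - x) x := by
    have c6 : Continuous fun x => e (b - x) x :=
      hcont2 he_cont (continuous_const.sub continuous_id) continuous_id
    have c7 : Continuous fun x => fl (b - x) x :=
      hcont2 hfl_cont (continuous_const.sub continuous_id) continuous_id
    rw [← integral_sub (c6.intervalIntegrable _ _) (c7.intervalIntegrable _ _)]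
    refine integral_congr fun x _ => ?_
    simp only [he_def, hfl_def]
    ring
  rw [hA, hC]
  simp only [he_def] at hswap ⊢
  linarith


end SourceIdentity

section Solutions

variable {V : ℝ → ℝ} {F ψ : ℝ → ℝ → ℝ}

/-- **Energy–flux identity with a source**, `C²` form: for `ψ` with `ContDiff ℝ 2 (uncurry ψ)`
solving `ψ_tt − ψ_xx + V(x)ψ = F` (continuous `V`, `F`; equation written with `iteratedDeriv 2`),
`s ≤ t`, `a + t ≤ b − t`:
`E(t) − E(s) = −∫_{a+s}^{a+t}[(ψ_t+ψ_x)² + Vψ²](x−a,x) − ∫_{b−t}^{b−s}[(ψ_t−ψ_x)² + Vψ²](b−x,x) + 2∫_s^t∫_{a+τ}^{b−τ} ψ_t F`.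
[folklore] -/
theorem wave1D_trapezoid_energy_identity_source (hV : Continuous V)
    (hF : Continuous (Function.uncurry F)) (hψ : ContDiff ℝ 2 (Function.uncurry ψ))
    (hsol : ∀ t x, iteratedDeriv 2 (fun τ => ψ τ x) t - iteratedDeriv 2 (ψ t) x + V x * ψ t x
      = F t x)
    {a b s t : ℝ} (hst : s ≤ t) (hab : a + t ≤ b - t) :
    (∫ x in (a + t)..(b - t),
        (deriv (fun τ => ψ τ x) t ^ 2 + deriv (ψ t) x ^ 2 + V x * ψ t x ^ 2))
      - ∫ x in (a + s)..(b - s),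
        (deriv (fun τ => ψ τ x) s ^ 2 + deriv (ψ s) x ^ 2 + V x * ψ s x ^ 2)
    = -(∫ x in (a + s)..(a + t), ((deriv (fun τ => ψ τ x) (x - a) + deriv (ψ (x - a)) x) ^ 2
          + V x * ψ (x - a) x ^ 2))
      - (∫ x in (b - t)..(b - s), ((deriv (fun τ => ψ τ x) (b - x) - deriv (ψ (b - x)) x) ^ 2
          + V x * ψ (b - x) x ^ 2))
      + 2 * ∫ τ in s..t, ∫ x in (a + τ)..(b - τ), deriv (fun σ => ψ σ x) τ * F τ x := by
  obtain ⟨ψt, ψx, ψtt, ψtx, ψxx, hct, hcx, -, hctx, hcxx, h1, h2, h3, h4, h5, h6, h7, h8⟩ :=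
    exists_partials_of_contDiff_two hψ
  have h3' : ∀ t x, HasDerivAt (fun τ => ψt τ x) (ψxx t x - V x * ψ t x + F t x) t := by
    intro t x
    refine (h3 t x).congr_deriv ?_
    have := hsol t x
    rw [h7, h8] at this
    linarith
  have hd1 : ∀ t x, deriv (fun τ => ψ τ x) t = ψt t x := fun t x => (h1 t x).deriv
  have hd2 : ∀ t x, deriv (ψ t) x = ψx t x := fun t x => (h2 t x).deriv
  simp only [hd1, hd2]
  exact trapezoid_energy_identity_source hV hF hψ.continuous hct hcx hctx hcxx h1 h3' h4 h5 h6
    hst hab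

/-- **Energy inequality with a source** on a characteristic trapezoid: for `V ≥ 0` the fluxes are
signed, so `E(t) − E(s) ≤ 2∫_s^t ∫_{a+τ}^{b−τ} ψ_t F`. [folklore] -/
theorem wave1D_trapezoid_energy_sub_le_source (hV : Continuous V) (hV0 : ∀ x, 0 ≤ V x)
    (hF : Continuous (Function.uncurry F)) (hψ : ContDiff ℝ 2 (Function.uncurry ψ))
    (hsol : ∀ t x, iteratedDeriv 2 (fun τ => ψ τ x) t - iteratedDeriv 2 (ψ t) x + V x * ψ t x
      = F t x)
    {a b s t : ℝ} (hst : s ≤ t) (hab : a + t ≤ b - t) :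
    (∫ x in (a + t)..(b - t),
        (deriv (fun τ => ψ τ x) t ^ 2 + deriv (ψ t) x ^ 2 + V x * ψ t x ^ 2))
      - ∫ x in (a + s)..(b - s),
        (deriv (fun τ => ψ τ x) s ^ 2 + deriv (ψ s) x ^ 2 + V x * ψ s x ^ 2)
    ≤ 2 * ∫ τ in s..t, ∫ x in (a + τ)..(b - τ), deriv (fun σ => ψ σ x) τ * F τ x := by
  have hid := wave1D_trapezoid_energy_identity_source hV hF hψ hsol hst hab
  have hA : 0 ≤ ∫ x in (a + s)..(a + t), ((deriv (fun τ => ψ τ x) (x - a) + deriv (ψ (x - a)) x) ^ 2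
      + V x * ψ (x - a) x ^ 2) :=
    intervalIntegral.integral_nonneg (by linarith) fun x _ => by
      have := hV0 x; positivity
  have hB : 0 ≤ ∫ x in (b - t)..(b - s), ((deriv (fun τ => ψ τ x) (b - x) - deriv (ψ (b - x)) x) ^ 2
      + V x * ψ (b - x) x ^ 2) :=
    intervalIntegral.integral_nonneg (by linarith) fun x _ => by
      have := hV0 x; positivity
  linarith

end Solutions

end Literature.Analysis.PDE
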